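import Literature.Barriers.CriticalPhenomena.PlaquetteWalkYBCurveIdentity
import HarnessLib

/-!
# Barrier catalogue (SAWScalingLimit), positive side: the exact vertex identity on the complexified
Yang–Baxter curve at ALL SIXTEEN admissible spins `t¹⁶ = −1`, by Galois conjugation

Companion of `PlaquetteWalkYBCurveIdentity` (the identity at `σ = 5/8`, `t₀ = e^{−5iπ/16}`: every good
point `ybCurve (−1) t₀ r` of the complexified Yang–Baxter curve carries
`F(z_E) + r F(z_N) − F(z_W) − r F(z_S) = 0` at every face of every finite face list for every OUTER
root), of `PlaquetteWalkYBCurveIdentityConj` (the same at four of the sixteen spins, by complex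
conjugation and phase reversal) and of `PlaquetteWalkYBCurveLocalForms` (at EVERY spin `t¹⁶ = −1` the
curve satisfies the fourteen LOCAL forms of the necessity chain). This file proves the GLOBAL identity
at every admissible spin at once:

* `vertexFunctional_ybCurve_eq_zero_of_pow_sixteen` — for every `t ∈ ℂ` with `t¹⁶ = −1`, every
  `r ∈ ℂ` with `r ≠ 0` and `t⁶(1 + r⁴) − (1 + t¹²) r² ≠ 0`, every finite face list `Dl`, every outer
  root `a` and every face `f₀ ∈ Dl`:
  `vertexFunctional (ybCurve (−1) t r) t (1, r, −1, −r) Dl a f₀ = 0`;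
  named `PlaquetteWalkYBCurveIdentityAllSpins` / `PlaquetteWalkYBCurveIdentityAllSpins_holds`; the
  row-convex technique class for both sign components (`exactPlaquetteVertexRelationRC_ybCurve_of_pow_sixteen`,
  `…_one_of_pow_sixteen`);
* the COMPLETE TWO-SIDED CLASSIFICATION of exact plaquette vertex relations on `ℤ²` with
  `u₁u₂v ≠ 0`, at every phase `t ≠ 0`, one technique class on both sides (row-convex face lists,
  boundary roots): `(∃ c ≠ 0, ExactPlaquetteVertexRelationRC W t c) ↔ (t¹⁶ = −1 ∧ ∃ ε = ±1, ∃ r, W = ybCurve ε t r)`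
  (`PlaquetteWalkYBClassificationAllSpins_holds`; necessity = the tree's spin rigidity and weight
  rigidity from the row-convex class, sufficiency = this file).

## The argument (Galois conjugation of the spin)

The sixteen admissible phases `t`, `t¹⁶ = −1` (`t = e^{−iσπ/2}`, `σ = ℓ/8`, `ℓ` odd), are the
primitive 32nd roots of unity — the roots of the cyclotomic polynomial `Φ₃₂ = T¹⁶ + 1`, irreducible
over `ℚ` (`Polynomial.cyclotomic.irreducible_rat`), so they are conjugate under `Gal(ℚ(ζ₃₂)/ℚ)`.
Everything in the identity is defined over `ℚ`: the curve `ybCurve (−1) t r` has coordinates in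
`ℚ(t, r)` (closed forms with integer coefficients), the coefficient vector is `(1, r, −1, −r)`, the
walk weights are monomials in the coordinates and the parafermionic factor is `t^{q(γ)}`, `q(γ) ∈ ℤ`.
Hence for fixed `(Dl, a, f₀)` the vertex functional is `P(t, r) / D(t, r)^n` with `P ∈ ℚ[T][R]` and
`D = T·R·(T⁴ − 1)·(T⁶(1 + R⁴) − (1 + T¹²)R²)` (`IsRat2`). At `t = t₀` it vanishes for every good `r`
(the tree's `PlaquetteWalkYBCurveIdentity_holds`), an infinite set, so every coefficient
`p_j ∈ ℚ[T]` of `P = Σ_j p_j(T) R^j` has `p_j(t₀) = 0`; the minimal polynomial `T¹⁶ + 1` of `t₀` over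
`ℚ` divides `p_j`, so `p_j(t₁) = 0` for every `t₁` with `t₁¹⁶ = −1`, i.e. `P(t₁, ·) ≡ 0` and the
identity holds at `t₁`.

Sources. A. Glazman, Electron. Commun. Probab. 20 (2015) no. 86, Lemma 3.1: for every spin
`σ = ℓ/8`, `ℓ` odd, and every rhombus angle the weights solving the local linear system exist, are
unique and given by (3.3)–(3.7) [cite: Glazman2015WeightedSAW, Lemma 3.1 and Appendix]; A. Glazman,
I. Manolescu, arXiv:1708.00395, eq. (1) and Lemma 2.1 (the `σ = 5/8` member and the relation on
domains) [cite: GlazmanManolescu2019, Lemma 2.1]; the general-domain root quantifier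
[cite: DuminilCopinSmirnov2012, Lemma 1]. Status in print: on the unit circle the identity at every spin
`σ = ℓ/8` is [cite: Glazman2015WeightedSAW, Lemma 3.1 (ECP 20 (2015) no. 86 pp. 5–7; Appendix p. 12)]
(parallelograms) and [cite: GlazmanManolescu2019, Lemma 2.1 (arXiv v3 pp. 6–7)] (`σ = 5/8`, rectangles);
the off-circle / general-domain identity at all sixteen spins and the all-phase classification proved
here are not located in print (print: real weights, `|r| = 1`), and the Galois-conjugation transfer
between admissible spins is not located in print either — CONSOLIDATION AT KERNEL RIGOUR on the circle,
NEW-IN-WRITING (modest) beyond it (label cell of record lit-2 g16, 2026-08-23); nearest for the spin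
condition at all sixteen spins at once (locally, real weights):
[cite: IkhlefCardy2009, §3 (cos 4πs = 0 at n = 0)], [cite: AlamBatchelor2014, §3.2 (1 − σ = 3η/π + ℓ/2)].
The transfer uses only that the weights, coefficients and phases are rational functions of `(t, r)`
over `ℚ` and that the admissible spins are the roots of the irreducible `Φ₃₂`; it says nothing about
phases outside `t¹⁶ = −1` (excluded by the tree's necessity theorem) and nothing about other lattices.

Written for the venture lane «pcv-sawmu» (Tier B, item C-B4 of HOME/STRUCTURE.md §2: «the curve
identity holds at all sixteen spins»; b-engine-1 gen 11).
-/

noncomputable section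

open Polynomial

namespace Literature.Barriers.CriticalPhenomena.PlaquetteWalk

open Literature.Probability.RandomPlanarGeometry.SAW.YangBaxter Real Complex

/-! ### Bivariate polynomials over `ℚ` evaluated at `(t, r) ∈ ℂ²` -/

/-- Evaluation of `P ∈ ℚ[T][R]` at `(t, r) ∈ ℂ²` (inner variable `T ↦ t`, outer variable `R ↦ r`),
a ring homomorphism. [folklore] -/
private def ev (t r : ℂ) : Polynomial (Polynomial ℚ) →+* ℂ :=
  Polynomial.eval₂RingHom (Polynomial.aeval t).toRingHom r

/-- The spin variable `T` of `ℚ[T][R]`. [folklore] -/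
private def TT : Polynomial (Polynomial ℚ) := Polynomial.C Polynomial.X

/-- The ratio variable `R` of `ℚ[T][R]`. [folklore] -/
private def RR : Polynomial (Polynomial ℚ) := Polynomial.X

/-- `ev` on constants of the inner ring. [folklore] -/
private theorem ev_C (t r : ℂ) (p : Polynomial ℚ) : ev t r (Polynomial.C p) = Polynomial.aeval t p := by
  simp [ev]

/-- `ev t r T = t`. [folklore] -/
@[simp] private theorem ev_TT (t r : ℂ) : ev t r TT = t := by
  rw [TT, ev_C, Polynomial.aeval_X]

/-- `ev t r R = r`. [folklore] -/
@[simp] private theorem ev_RR (t r : ℂ) : ev t r RR = r := by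
  simp [ev, RR]

/-- `ev t r P = (P.map (T ↦ t)).eval r`. [folklore] -/
private theorem ev_eq_eval_map (t r : ℂ) (P : Polynomial (Polynomial ℚ)) :
    ev t r P = (P.map (Polynomial.aeval t).toRingHom).eval r := by
  rw [Polynomial.eval_map]; rfl

/-- The master denominator `D(T, R) = T · R · (T⁴ − 1) · (T⁶(1 + R⁴) − (1 + T¹²) R²)` — the product of
the denominators of the curve's closed forms (`ybV`, `ybU1`, `ybU2`, `ybW1`, `ybW2` at `ε = −1`) and of
`t^{q}`, `q < 0`. [folklore] -/
private def DD : Polynomial (Polynomial ℚ) :=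
  TT * RR * (TT ^ 4 - 1) * (TT ^ 6 * (1 + RR ^ 4) - (1 + TT ^ 12) * RR ^ 2)

/-- Evaluation of the master denominator. [folklore] -/
private theorem ev_DD (t r : ℂ) :
    ev t r DD = t * r * (t ^ 4 - 1) * (t ^ 6 * (1 + r ^ 4) - (1 + t ^ 12) * r ^ 2) := by
  simp [DD, map_mul, map_sub, map_add, map_pow]

/-- `IsRat2 f`: off the zero set of the master denominator, `f(t, r) = P(t, r)/D(t, r)^n` for a
bivariate polynomial `P` with RATIONAL coefficients. [folklore] -/
private def IsRat2 (f : ℂ → ℂ → ℂ) : Prop :=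
  ∃ (P : Polynomial (Polynomial ℚ)) (n : ℕ), ∀ t r : ℂ, ev t r DD ≠ 0 → f t r = ev t r P / ev t r DD ^ n

namespace IsRat2

variable {f g : ℂ → ℂ → ℂ}

/-- Pointwise congruence off the zero set of `D`. [folklore] -/
private theorem congr' (hf : IsRat2 f) (h : ∀ t r, ev t r DD ≠ 0 → g t r = f t r) : IsRat2 g := by
  obtain ⟨P, n, hP⟩ := hf
  exact ⟨P, n, fun t r hr => by rw [h t r hr, hP t r hr]⟩

/-- The constant `1`. [folklore] -/
private theorem one : IsRat2 fun _ _ => 1 :=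
  ⟨1, 0, fun _ _ _ => by simp⟩

/-- The spin variable. [folklore] -/
private theorem tt : IsRat2 fun t _ => t :=
  ⟨TT, 0, fun _ _ _ => by simp⟩

/-- The ratio variable. [folklore] -/
private theorem rr : IsRat2 fun _ r => r :=
  ⟨RR, 0, fun _ _ _ => by simp⟩

/-- Sums. [folklore] -/
private theorem add (hf : IsRat2 f) (hg : IsRat2 g) : IsRat2 fun t r => f t r + g t r := by
  obtain ⟨P, n, hP⟩ := hf
  obtain ⟨R, m, hR⟩ := hg
  refine ⟨P * DD ^ m + R * DD ^ n, n + m, fun t r hr => ?_⟩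
  beta_reduce
  rw [hP t r hr, hR t r hr, div_add_div _ _ (pow_ne_zero n hr) (pow_ne_zero m hr)]
  simp only [map_add, map_mul, map_pow, pow_add]
  ring

/-- Products. [folklore] -/
private theorem mul (hf : IsRat2 f) (hg : IsRat2 g) : IsRat2 fun t r => f t r * g t r := by
  obtain ⟨P, n, hP⟩ := hf
  obtain ⟨R, m, hR⟩ := hg
  refine ⟨P * R, n + m, fun t r hr => ?_⟩
  beta_reduce
  rw [hP t r hr, hR t r hr, div_mul_div_comm, ← pow_add, map_mul]

/-- Negation. [folklore] -/
private theorem neg (hf : IsRat2 f) : IsRat2 fun t r => -f t r := by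
  obtain ⟨P, n, hP⟩ := hf
  exact ⟨-P, n, fun t r hr => by beta_reduce; rw [hP t r hr, map_neg, neg_div]⟩

/-- Differences. [folklore] -/
private theorem sub (hf : IsRat2 f) (hg : IsRat2 g) : IsRat2 fun t r => f t r - g t r :=
  (hf.add hg.neg).congr' fun _ _ _ => sub_eq_add_neg _ _

/-- Natural powers. [folklore] -/
private theorem pow (hf : IsRat2 f) (k : ℕ) : IsRat2 fun t r => f t r ^ k := by
  induction k with
  | zero => exact one.congr' fun _ _ _ => pow_zero _
  | succ k ih => exact (ih.mul hf).congr' fun _ _ _ => pow_succ _ _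

/-- Finite sums. [folklore] -/
private theorem sum {ι : Type*} (s : Finset ι) {F : ι → ℂ → ℂ → ℂ} (h : ∀ i ∈ s, IsRat2 (F i)) :
    IsRat2 fun t r => ∑ i ∈ s, F i t r := by
  classical
  induction s using Finset.induction_on with
  | empty => exact (one.sub one).congr' fun _ _ _ => by simp
  | insert i s hi ih =>
    exact ((h i (Finset.mem_insert_self _ _)).add (ih fun j hj => h j (Finset.mem_insert_of_mem hj))).congr'
      fun _ _ _ => Finset.sum_insert hi

/-- The inverse of a factor of `D`. [folklore] -/
private theorem inv_of_factor {A B : Polynomial (Polynomial ℚ)} (hD : DD = A * B) :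
    IsRat2 fun t r => (ev t r B)⁻¹ := by
  refine ⟨A, 1, fun t r hr => ?_⟩
  rw [hD, map_mul] at hr ⊢
  have hB : ev t r B ≠ 0 := right_ne_zero_of_mul hr
  have hA : ev t r A ≠ 0 := left_ne_zero_of_mul hr
  rw [pow_one, eq_div_iff (mul_ne_zero hA hB), mul_comm (ev t r A), inv_mul_cancel_left₀ hB]

/-- `1/t`. [folklore] -/
private theorem inv_t : IsRat2 fun t _ => t⁻¹ :=
  (inv_of_factor (A := RR * (TT ^ 4 - 1) * (TT ^ 6 * (1 + RR ^ 4) - (1 + TT ^ 12) * RR ^ 2)) (B := TT)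
    (by rw [DD]; ring)).congr' fun t r _ => by rw [ev_TT]

/-- Integer powers of the spin variable. [folklore] -/
private theorem zpow_t (q : ℤ) : IsRat2 fun t _ => t ^ q := by
  cases q with
  | ofNat n => exact (tt.pow n).congr' fun t _ _ => by rw [Int.ofNat_eq_natCast, zpow_natCast]
  | negSucc n => exact (inv_t.pow (n + 1)).congr' fun t _ _ => by rw [zpow_negSucc, inv_pow]

end IsRat2

/-! ### Galois conjugacy of the sixteen admissible spins -/

/-- `Φ₃₂ = T¹⁶ + 1`. [folklore] -/
private theorem cyclotomic_thirtyTwo : Polynomial.cyclotomic 32 ℚ = X ^ 16 + 1 := by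
  rw [show (32 : ℕ) = 2 ^ (4 + 1) by norm_num, Polynomial.cyclotomic_prime_pow_eq_geom_sum Nat.prime_two]
  simp [Finset.sum_range_succ]
  ring

/-- `T¹⁶ + 1` is irreducible over `ℚ`. [folklore] -/
private theorem irreducible_X_pow_sixteen_add_one : Irreducible (X ^ 16 + 1 : Polynomial ℚ) := by
  rw [← cyclotomic_thirtyTwo]
  exact Polynomial.cyclotomic.irreducible_rat (by norm_num)

/-- The minimal polynomial over `ℚ` of any `t ∈ ℂ` with `t¹⁶ = −1` is `T¹⁶ + 1`. [folklore] -/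
private theorem minpoly_eq_of_pow_sixteen {t : ℂ} (h : t ^ 16 = -1) : minpoly ℚ t = X ^ 16 + 1 := by
  refine (minpoly.eq_of_irreducible_of_monic irreducible_X_pow_sixteen_add_one ?_ ?_).symm
  · simp [h]
  · simpa using Polynomial.monic_X_pow_add_C (1 : ℚ) (n := 16) (by norm_num)

/-- **Galois conjugation of the spin**: a polynomial with rational coefficients vanishing at one
admissible spin `t₀` (`t₀¹⁶ = −1`) vanishes at every admissible spin `t₁`. [folklore] -/
private theorem aeval_eq_zero_of_pow_sixteen {p : Polynomial ℚ} {t₀ t₁ : ℂ} (h₀ : t₀ ^ 16 = -1)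
    (h₁ : t₁ ^ 16 = -1) (hp : Polynomial.aeval t₀ p = 0) : Polynomial.aeval t₁ p = 0 := by
  have hdvd : X ^ 16 + 1 ∣ p := by
    rw [← minpoly_eq_of_pow_sixteen h₀]
    exact minpoly.dvd ℚ t₀ hp
  exact Polynomial.aeval_eq_zero_of_dvd_aeval_eq_zero hdvd (by simp [h₁])

/-- `t¹⁶ = −1 ⇒ t ≠ 0`. [folklore] -/
private theorem ne_zero_of_pow_sixteen {t : ℂ} (h : t ^ 16 = -1) : t ≠ 0 := by
  rintro rfl; norm_num at h

/-- `t¹⁶ = −1 ⇒ t⁴ ≠ 1`. [folklore] -/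
private theorem pow_four_ne_one_of_pow_sixteen {t : ℂ} (h : t ^ 16 = -1) : t ^ 4 ≠ 1 := by
  intro h4
  have : t ^ 16 = 1 := by
    calc t ^ 16 = (t ^ 4) ^ 4 := by ring
      _ = 1 := by rw [h4]; norm_num
  rw [h] at this; norm_num at this

/-- For `t ≠ 0`, `t⁴ ≠ 1` the good set `{r : D(t, r) ≠ 0}` is infinite (the complement of the root set
of a nonzero polynomial of degree five). [folklore] -/
private theorem infinite_good {t : ℂ} (ht : t ≠ 0) (ht4 : t ^ 4 ≠ 1) : {x : ℂ | ev t x DD ≠ 0}.Infinite := by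
  -- the `r`-polynomial `Q_t(X) = C(t(t⁴−1)) · X · (C(t⁶)(1 + X⁴) − C(1 + t¹²) X²)`
  set Q : Polynomial ℂ := Polynomial.C (t * (t ^ 4 - 1)) *
    (X * (Polynomial.C (t ^ 6) * (1 + X ^ 4) - Polynomial.C (1 + t ^ 12) * X ^ 2)) with hQ
  have hQev : ∀ x : ℂ, Q.eval x = ev t x DD := fun x => by
    rw [ev_DD, hQ]; simp only [eval_mul, eval_C, eval_X, eval_sub, eval_add, eval_pow, eval_one]; ring
  have hQne : Q ≠ 0 := by
    rw [hQ]
    refine mul_ne_zero (Polynomial.C_ne_zero.2 (mul_ne_zero ht (sub_ne_zero.2 ht4))) (mul_ne_zero X_ne_zero ?_)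
    intro h
    have h0 := congrArg (Polynomial.eval 0) h
    simp [ht] at h0
  have hsub : {x : ℂ | Q.IsRoot x}ᶜ ⊆ {x : ℂ | ev t x DD ≠ 0} := fun x hx => by
    simpa [Set.mem_compl_iff, Set.mem_setOf_eq, IsRoot.def, hQev x] using hx
  exact ((Polynomial.finite_setOf_isRoot hQne).infinite_compl).mono hsub

/-- **Transfer across the spins**: an `IsRat2` function that vanishes on the good set at one admissible
spin `t₀` vanishes on the good set at every admissible spin `t₁`. [folklore] -/
private theorem IsRat2.eq_zero_of_spin {f : ℂ → ℂ → ℂ} (hf : IsRat2 f) {t₀ t₁ : ℂ}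
    (h₀ : t₀ ^ 16 = -1) (h₁ : t₁ ^ 16 = -1) (hz : ∀ r : ℂ, ev t₀ r DD ≠ 0 → f t₀ r = 0)
    {r : ℂ} (hr : ev t₁ r DD ≠ 0) : f t₁ r = 0 := by
  obtain ⟨P, n, hP⟩ := hf
  -- the specialisation `P(t₀, ·) ∈ ℂ[R]` has infinitely many roots, hence is zero
  have hP₀ : P.map (Polynomial.aeval t₀).toRingHom = 0 := by
    refine Polynomial.eq_zero_of_infinite_isRoot _
      ((infinite_good (ne_zero_of_pow_sixteen h₀) (pow_four_ne_one_of_pow_sixteen h₀)).mono fun x hx => ?_)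
    have h := hP t₀ x hx
    rw [hz x hx, eq_comm, div_eq_zero_iff] at h
    have hPx : ev t₀ x P = 0 := h.resolve_right (pow_ne_zero n hx)
    rw [ev_eq_eval_map] at hPx
    exact hPx
  -- so every coefficient `p_j ∈ ℚ[T]` vanishes at `t₀`, hence at `t₁`
  have hP₁ : P.map (Polynomial.aeval t₁).toRingHom = 0 := by
    ext j
    have h0 : Polynomial.aeval t₀ (P.coeff j) = 0 := by
      have := congrArg (fun q => Polynomial.coeff q j) hP₀
      simpa [Polynomial.coeff_map] using this
    simpa [Polynomial.coeff_map] using aeval_eq_zero_of_pow_sixteen h₀ h₁ h0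
  rw [hP t₁ r hr, ev_eq_eval_map, hP₁, eval_zero, zero_div]

/-! ### The curve data are rational over `ℚ` in `(t, r)` -/

section Curve

open IsRat2

/-- `1/(t⁶(1 + r⁴) − (1 + t¹²) r²)`. [folklore] -/
private theorem isRat2_inv_den : IsRat2 fun t r => (t ^ 6 * (1 + r ^ 4) - (1 + t ^ 12) * r ^ 2)⁻¹ :=
  (inv_of_factor (A := TT * RR * (TT ^ 4 - 1)) (B := TT ^ 6 * (1 + RR ^ 4) - (1 + TT ^ 12) * RR ^ 2)
    rfl).congr' fun t r _ => by simp [map_mul, map_sub, map_add, map_pow]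

/-- `1/((−1) · r · (t⁴ − 1))`. [folklore] -/
private theorem isRat2_inv_εr : IsRat2 fun t r => ((-1 : ℂ) * r * (t ^ 4 - 1))⁻¹ :=
  ((inv_of_factor (A := TT * (TT ^ 6 * (1 + RR ^ 4) - (1 + TT ^ 12) * RR ^ 2)) (B := RR * (TT ^ 4 - 1))
    (by rw [DD]; ring)).neg).congr' fun t r _ => by
    simp only [map_mul, map_sub, map_pow, map_one, ev_TT, ev_RR]
    rw [show ((-1 : ℂ) * r * (t ^ 4 - 1)) = -(r * (t ^ 4 - 1)) by ring, inv_neg]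

/-- The straight weight on the odd curve. [folklore] -/
private theorem isRat2_ybV : IsRat2 fun t r => ybV (-1) t r := by
  have hN : IsRat2 fun t r => t ^ 6 * (1 + r ^ 4) - (t ^ 4 + t ^ 8) * r ^ 2 :=
    ((tt.pow 6).mul (one.add (rr.pow 4))).sub (((tt.pow 4).add (tt.pow 8)).mul (rr.pow 2))
  exact ((one.neg.neg.mul hN).mul isRat2_inv_den).congr' fun t r _ => by rw [ybV, div_eq_mul_inv]

/-- `1 + (−1) v`. [folklore] -/
private theorem isRat2_one_add : IsRat2 fun t r => 1 + (-1) * ybV (-1) t r :=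
  one.add (one.neg.mul isRat2_ybV)

/-- The corner weight on the odd curve. [folklore] -/
private theorem isRat2_ybU1 : IsRat2 fun t r => ybU1 (-1) t r :=
  (((tt.mul isRat2_one_add).mul ((rr.pow 2).sub (tt.pow 2))).mul isRat2_inv_εr).congr'
    fun t r _ => by rw [ybU1, div_eq_mul_inv]

/-- The co-corner weight on the odd curve. [folklore] -/
private theorem isRat2_ybU2 : IsRat2 fun t r => ybU2 (-1) t r :=
  (((one.neg.neg.mul isRat2_ybU1).sub ((tt.mul isRat2_one_add).mul rr)).mul (inv_t.pow 2)).congr'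
    fun t r _ => by rw [ybU2, div_eq_mul_inv, inv_pow]

/-- The two-corner weight on the odd curve. [folklore] -/
private theorem isRat2_ybW1 : IsRat2 fun t r => ybW1 (-1) t r :=
  (((one.neg.neg.mul isRat2_ybV).sub (((one.neg.mul isRat2_ybU1).mul (tt.pow 5)).mul rr)).mul
    (inv_t.pow 4)).congr' fun t r _ => by rw [ybW1, div_eq_mul_inv, inv_pow]

/-- The two-co-corner weight on the odd curve. [folklore] -/
private theorem isRat2_ybW2 : IsRat2 fun t r => ybW2 (-1) t r :=
  ((((one.neg.neg.mul isRat2_ybV).mul (tt.pow 5)).sub (isRat2_ybU2.mul rr)).mul inv_t).congr'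
    fun t r _ => by rw [ybW2, div_eq_mul_inv]

/-- The plaquette weight of a mid-edge list on the odd curve.
[cite: GlazmanManolescu2019, §1 (the weight of a walk is the product of the rhombus weights)] -/
private theorem isRat2_weightL (l : List MidEdge) : IsRat2 fun t r => weightL (ybCurve (-1) t r) l :=
  (((((isRat2_ybU1.pow (cfgCount l [.corner])).mul (isRat2_ybU2.pow (cfgCount l [.coCorner]))).mul
    (isRat2_ybV.pow (cfgCount l [.straight]))).mul (isRat2_ybW1.pow (cfgCount l [.corner, .corner]))).mul
    (isRat2_ybW2.pow (cfgCount l [.coCorner, .coCorner]))).congr' fun _ _ _ => by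
    simp only [weightL, CWeights.mono, ybCurve]

/-- The free-weight observable on the odd curve. [cite: GlazmanManolescu2019, §2.1, eq. (2.1)] -/
private theorem isRat2_gmObservable (Dl : List Face) (a z : MidEdge) :
    IsRat2 fun t r => gmObservable (ybCurve (-1) t r) t Dl a z :=
  (IsRat2.sum (Finset.univ : Finset (YBWalk (dom Dl) a z))
    (F := fun γ t r => weightL (ybCurve (-1) t r) γ.mids * t ^ quarterTurnsL γ.mids)
    fun γ _ => (isRat2_weightL γ.mids).mul (zpow_t (quarterTurnsL γ.mids))).congr'
    fun _ _ _ => by rw [gmObservable]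

/-- Each coefficient `(1, r, −1, −r)_s`. [cite: GlazmanManolescu2019, Lemma 2.1, eq. (CR)] -/
private theorem isRat2_oddCoeff (s : Fin 4) : IsRat2 fun _ r => oddCoeff r s := by
  fin_cases s
  · exact one.congr' fun _ _ _ => rfl
  · exact rr.congr' fun _ _ _ => rfl
  · exact one.neg.congr' fun _ _ _ => rfl
  · exact rr.neg.congr' fun _ _ _ => rfl

/-- **The vertex functional on the odd curve is a rational function over `ℚ` of the spin variable and
the coefficient ratio.** [cite: DuminilCopinSmirnov2012, Lemma 1 (shape of the relation)] -/
private theorem isRat2_vertexFunctional (Dl : List Face) (a : MidEdge) (f₀ : Face) :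
    IsRat2 fun t r => vertexFunctional (ybCurve (-1) t r) t (oddCoeff r) Dl a f₀ :=
  (IsRat2.sum (Finset.univ : Finset (Fin 4))
    (F := fun s t r => oddCoeff r s * gmObservable (ybCurve (-1) t r) t Dl a (slotSide f₀ s))
    fun s _ => (isRat2_oddCoeff s).mul (isRat2_gmObservable Dl a _)).congr'
    fun _ _ _ => by rw [vertexFunctional]

end Curve

/-! ### The identity at every admissible spin -/

/-- **The exact vertex identity on the complexified Yang–Baxter curve at EVERY admissible spin**:
for every `t ∈ ℂ` with `t¹⁶ = −1`, every `r ∈ ℂ` with `r ≠ 0` and `t⁶(1 + r⁴) − (1 + t¹²) r² ≠ 0`,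
the weights `ybCurve (−1) t r` satisfy `F(z_E) + r F(z_N) − F(z_W) − r F(z_S) = 0` at every face of
every finite face list for every OUTER root. Proof: Galois conjugation of the spin from `σ = 5/8`
(`PlaquetteWalkYBCurveIdentity_holds`). [cite: Glazman2015WeightedSAW, Lemma 3.1 (the σ = ℓ/8 families)]
[cite: GlazmanManolescu2019, Lemma 2.1] -/
theorem vertexFunctional_ybCurve_eq_zero_of_pow_sixteen {t : ℂ} (h16 : t ^ 16 = -1) {r : ℂ} (hr : r ≠ 0)
    (hD : t ^ 6 * (1 + r ^ 4) - (1 + t ^ 12) * r ^ 2 ≠ 0)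
    (Dl : List Face) (a : MidEdge) (hO : OuterRoot (dom Dl) a) (f₀ : Face) (hf : f₀ ∈ Dl) :
    vertexFunctional (ybCurve (-1) t r) t (oddCoeff r) Dl a f₀ = 0 := by
  have hgood : ev t r DD ≠ 0 := by
    rw [ev_DD]
    exact mul_ne_zero (mul_ne_zero (mul_ne_zero (ne_zero_of_pow_sixteen h16) hr)
      (sub_ne_zero.2 (pow_four_ne_one_of_pow_sixteen h16))) hD
  refine (isRat2_vertexFunctional Dl a f₀).eq_zero_of_spin tFiveEighths_pow_sixteen h16 (fun x hx => ?_) hgood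
  rw [ev_DD] at hx
  obtain ⟨h123, hxD⟩ := mul_ne_zero_iff.1 hx
  obtain ⟨h12, -⟩ := mul_ne_zero_iff.1 h123
  obtain ⟨-, hx0⟩ := mul_ne_zero_iff.1 h12
  exact PlaquetteWalkYBCurveIdentity_holds x hx0 hxD Dl a f₀ hf hO

/-- **Named statement `PlaquetteWalkYBCurveIdentityAllSpins`** (the venture lane's item C-B4, now a theorem):
at EVERY admissible spin `t¹⁶ = −1` every good point `ybCurve (−1) t r` of the complexified
Yang–Baxter curve carries the exact vertex identity with coefficients `(1, r, −1, −r)` on every finite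
face list for every outer root. [cite: Glazman2015WeightedSAW, Lemma 3.1 (the σ = ℓ/8 families)]
[cite: GlazmanManolescu2019, Lemma 2.1] -/
def _root_.Literature.Barriers.CriticalPhenomena.PlaquetteWalkYBCurveIdentityAllSpins : Prop :=
  ∀ t : ℂ, t ^ 16 = -1 → ∀ r : ℂ, r ≠ 0 → t ^ 6 * (1 + r ^ 4) - (1 + t ^ 12) * r ^ 2 ≠ 0 →
    ∀ (Dl : List Face) (a : MidEdge) (f₀ : Face), f₀ ∈ Dl → OuterRoot (dom Dl) a →
      vertexFunctional (ybCurve (-1) t r) t (oddCoeff r) Dl a f₀ = 0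

/-- **`PlaquetteWalkYBCurveIdentityAllSpins` holds.** [cite: Glazman2015WeightedSAW, Lemma 3.1 (the σ = ℓ/8 families)] -/
theorem _root_.Literature.Barriers.CriticalPhenomena.PlaquetteWalkYBCurveIdentityAllSpins_holds :
    PlaquetteWalkYBCurveIdentityAllSpins :=
  fun _ h16 _ hr hD Dl a f₀ hf hO => vertexFunctional_ybCurve_eq_zero_of_pow_sixteen h16 hr hD Dl a hO f₀ hf

/-- Consistency: the `σ = 5/8` identity `PlaquetteWalkYBCurveIdentity` is the member `t = e^{−5iπ/16}`.
[cite: GlazmanManolescu2019, Lemma 2.1] -/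
example : PlaquetteWalkYBCurveIdentity :=
  fun _ hr hD Dl a f₀ hf hO =>
    PlaquetteWalkYBCurveIdentityAllSpins_holds _ tFiveEighths_pow_sixteen _ hr hD Dl a f₀ hf hO

/-- **Row-convex class, odd component, every admissible spin.** [cite: GlazmanManolescu2019, Lemma 2.1] -/
theorem exactPlaquetteVertexRelationRC_ybCurve_of_pow_sixteen {t : ℂ} (h16 : t ^ 16 = -1) {r : ℂ}
    (hr : r ≠ 0) (hD : t ^ 6 * (1 + r ^ 4) - (1 + t ^ 12) * r ^ 2 ≠ 0) :
    ExactPlaquetteVertexRelationRC (ybCurve (-1) t r) t (oddCoeff r) :=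
  fun Dl a f₀ hD' hf ha => vertexFunctional_ybCurve_eq_zero_of_pow_sixteen h16 hr hD Dl a
    (outerRoot_of_noHoles (noHoles_of_rowConvex hD') ha) f₀ hf

/-- **Row-convex class, even component (sign gauge), every admissible spin.**
[cite: Glazman2015WeightedSAW, Lemma 3.1 (symmetries of the local system)] -/
theorem exactPlaquetteVertexRelationRC_ybCurve_one_of_pow_sixteen {t : ℂ} (h16 : t ^ 16 = -1) {r : ℂ}
    (hr : r ≠ 0) (hD : t ^ 6 * (1 + r ^ 4) - (1 + t ^ 12) * r ^ 2 ≠ 0) :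
    ExactPlaquetteVertexRelationRC (ybCurve 1 t r) t (gaugeCoeff (oddCoeff r)) := by
  intro Dl a f₀ hD' hf ha
  rw [ybCurve_one_eq_gauge, signGauge, vertexFunctional_gauge,
    exactPlaquetteVertexRelationRC_ybCurve_of_pow_sixteen h16 hr hD Dl a f₀ hD' hf ha, mul_zero]

/-! ### The complete two-sided classification at every phase -/

/-- At `r = 0` the closed form of the corner weight degenerates to `u₁ = 0`. [folklore] -/
private theorem ybU1_zero_right' (ε t : ℂ) : ybU1 ε t 0 = 0 := by
  simp [ybU1]

/-- On the zero set of the curve's denominator the closed form of the straight weight degenerates to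
`v = 0`. [folklore] -/
private theorem ybV_eq_zero_of_den_eq_zero' {ε t r : ℂ}
    (h : t ^ 6 * (1 + r ^ 4) - (1 + t ^ 12) * r ^ 2 = 0) : ybV ε t r = 0 := by
  rw [ybV, h, div_zero]

/-- **Named statement `PlaquetteWalkYBClassificationAllSpins`** — the complete two-sided classification
of exact plaquette vertex relations on `ℤ²` in the five-weight class with `u₁u₂v ≠ 0`, at every
phase `t ≠ 0` (spin `σ`, `t = e^{−iσπ/2}`), one technique class on both sides (row-convex face lists,
boundary roots): a weight system carries an exact vertex relation with SOME nonzero coefficient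
vector iff the spin is admissible (`t¹⁶ = −1`, i.e. `σ ∈ (2ℤ+1)/8`) AND the weights are a point
`ybCurve ε t r`, `ε = ±1`, `r ∈ ℂ`, of the complexified Yang–Baxter curve of that spin.
[cite: Glazman2015WeightedSAW, Lemma 3.1 ("for σ = ℓ/8 … the weights exist and are unique")]
[cite: GlazmanManolescu2019, Lemma 2.1] -/
def _root_.Literature.Barriers.CriticalPhenomena.PlaquetteWalkYBClassificationAllSpins : Prop :=
  ∀ (W : CWeights) (t : ℂ), t ≠ 0 → W.u₁ ≠ 0 → W.u₂ ≠ 0 → W.v ≠ 0 →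
    ((∃ c : Fin 4 → ℂ, c ≠ 0 ∧ ExactPlaquetteVertexRelationRC W t c) ↔
      (t ^ 16 = -1 ∧ ∃ ε r : ℂ, (ε = 1 ∨ ε = -1) ∧ W = ybCurve ε t r))

/-- **`PlaquetteWalkYBClassificationAllSpins` holds**: (→) spin rigidity and weight rigidity from the
row-convex class (`t_pow_sixteen_of_exactPlaquetteVertexRelationRC`, `weights_eq_ybCurveRC`, tree);
(←) the identity at every admissible spin (this file), the side conditions `r ≠ 0`, `Q_t(r) ≠ 0`
following from `u₁ ≠ 0`, `v ≠ 0`. [cite: Glazman2015WeightedSAW, Lemma 3.1] [cite: GlazmanManolescu2019, Lemma 2.1] -/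
theorem _root_.Literature.Barriers.CriticalPhenomena.PlaquetteWalkYBClassificationAllSpins_holds :
    PlaquetteWalkYBClassificationAllSpins := by
  intro W t ht h1 h2 hv
  constructor
  · rintro ⟨c, hc, hrel⟩
    obtain ⟨ε, hε, -, hW⟩ := weights_eq_ybCurveRC hrel ht h1 h2 hv hc
    exact ⟨t_pow_sixteen_of_exactPlaquetteVertexRelationRC hrel ht h1 h2 hv hc, ε, _, hε, hW⟩
  · rintro ⟨h16, ε, r, hε, rfl⟩
    have hr : r ≠ 0 := by rintro rfl; exact h1 (ybU1_zero_right' ε t)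
    have hD : t ^ 6 * (1 + r ^ 4) - (1 + t ^ 12) * r ^ 2 ≠ 0 := fun h => hv (ybV_eq_zero_of_den_eq_zero' h)
    rcases hε with rfl | rfl
    · exact ⟨gaugeCoeff (oddCoeff r), fun h => oddCoeff_ne_zero r (by
        rw [← gaugeCoeff_gaugeCoeff (oddCoeff r), h]; funext i; fin_cases i <;> simp [gaugeCoeff]),
        exactPlaquetteVertexRelationRC_ybCurve_one_of_pow_sixteen h16 hr hD⟩
    · exact ⟨oddCoeff r, oddCoeff_ne_zero r, exactPlaquetteVertexRelationRC_ybCurve_of_pow_sixteen h16 hr hD⟩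

/-- Consistency: the `σ = 5/8` classification `PlaquetteWalkYBCurveClassification` is the member
`t = e^{−5iπ/16}` (there the spin clause is automatic). [cite: GlazmanManolescu2019, Lemma 2.1] -/
example : PlaquetteWalkYBCurveClassification := by
  intro W h1 h2 hv
  rw [PlaquetteWalkYBClassificationAllSpins_holds W tFiveEighths tFiveEighths_ne_zero h1 h2 hv]
  exact ⟨fun h => h.2, fun h => ⟨tFiveEighths_pow_sixteen, h⟩⟩

end Literature.Barriers.CriticalPhenomena.PlaquetteWalk
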